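import Mathlib
import HarnessLib

/-!
# Bourgain's Mordell-type estimate for short sparse exponential sums in prime fields

Topic `Literature/NumberTheory/GaussSums` (additive character sums over `𝔽_p`). NAMED FACT (not
proved here): J. Bourgain, *Mordell's exponential sum estimate revisited*, J. Amer. Math. Soc. 18
(2005) 477–499, **Theorem 2, inequality (1.24) p. 480, under the hypotheses (1.19)–(1.20) p. 479**:
for `ε > 0` and `θ_1, …, θ_r ∈ 𝔽_p^*` with `o(θ_i) > p^ε` and `o(θ_i θ_j^{-1}) > p^ε` (`i ≠ j`), for
`t > p^ε`, `max_{a_i ∈ 𝔽_p^*} |Σ_{s=1}^{t} e_p(Σ_i a_i θ_i^s)| < p^{-δ} t` with `δ = δ(r, ε) > 0`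
(Theorem 1 p. 477 for the dependence of `δ`; `e_p(y) = e^{2πiy/p}` is Mathlib's `ZMod.stdAddChar`).

Stated here in the tree's vocabulary for `r = 1` and `r = 2` only, in NATURAL-NUMBER CLOTHING
(`ε = 1/k`, `δ = 1/j`, "for all primes `p ≥ p₀`", bound `≤ K₀` for every integer `K₀ ≥ p^{-1/j} t`):
every instance of `BourgainMordellTwoTerm` is an instance of the printed theorem (order `> L` with
`p < (L+1)^k` means order `> p^{1/k}`; `p < t^k` means `t > p^{1/k}`; `t^j ≤ K₀^j p` means
`p^{-1/j} t ≤ K₀`), and it is WEAKER than print in four declared places (`ε` restricted to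
reciprocals of integers; `δ` rounded down to `1/j`; only `p ≥ p₀`; non-strict `≤`). The `p ≥ p₀`
clause is the form of Bourgain's later survey statement (*Sum-product theorems and applications*,
2010, §8 Thm 3: `< C p^{-δ'} t`), the constant absorbed.
-- TODO(general form): arbitrary `r` (conditions (1.19)–(1.20) for all `i ≠ j`), real `ε, δ`, every
-- prime `p` with the strict bound `< p^{-δ} t`; composite moduli (ibid. §6).

* `MordellOneTermBound p L t K₀`, `MordellTwoTermBound p L t K₀` — the `r = 1`, `r = 2` conclusions
  at one prime as predicates (short orbit sums `Σ_{s<t} ψ(a θ^{s+1})`, resp. two-term, bounded by `K₀`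
  whenever the orders of `θ`, resp. `θ₁, θ₂, θ₁θ₂⁻¹`, exceed `L` and the coefficients are nonzero).
* `BourgainMordellTwoTerm` — the named fact.

Used by: the cell `valiant-natproofs` (route BarrierLever of `ValiantsHypothesis`): conditionally on
this fact, KRST's hitting-set generator is not `VP_{n,b}`-succinct for any `b < 12c` (ledger item
stmt-ValiantsHypothesis-19340, whose inlined hypothesis is this statement verbatim).

## References

* [Bourgain2005] J. Bourgain, *Mordell's exponential sum estimate revisited*, JAMS 18 (2005), Thm 2.
* [BourgainGlibichukKonyagin2006] J. Bourgain, A. Glibichuk, S. Konyagin, J. London Math. Soc. 73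
  (2006), Thm 1.1 (the `r = 1` case with an implied constant).
-/

noncomputable section

namespace Literature.NumberTheory.GaussSums

open scoped BigOperators

/-- Bourgain's one-term short-sum bound at the prime `p` with order threshold `L`, length `t` and
bound `K₀` (the `r = 1` conclusion of [Bourgain2005, Thm 2]): for every `θ ≠ 0` of multiplicative
order `> L` and every `a ≠ 0`, `‖Σ_{s<t} e_p(a θ^{s+1})‖ ≤ K₀`. A predicate (the theorem asserts it
under size conditions on `L, t, K₀`). [cite: Bourgain2005, Thm 2 (1.24), r = 1] -/
def MordellOneTermBound (p : ℕ) [Fact p.Prime] (L t K₀ : ℕ) : Prop :=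
  ∀ θ : ZMod p, θ ≠ 0 → L < orderOf θ → ∀ a : ZMod p, a ≠ 0 →
    ‖∑ s : Fin t, ((ZMod.stdAddChar : AddChar (ZMod p) ℂ) (a * θ ^ ((s : ℕ) + 1)) : ℂ)‖ ≤ K₀

/-- Bourgain's two-term short-sum bound at the prime `p` (the `r = 2` conclusion of
[Bourgain2005, Thm 2]): for `θ₁, θ₂ ≠ 0` with `o(θ₁), o(θ₂), o(θ₁θ₂⁻¹) > L` and `a₁, a₂ ≠ 0`,
`‖Σ_{s<t} e_p(a₁ θ₁^{s+1} + a₂ θ₂^{s+1})‖ ≤ K₀`. [cite: Bourgain2005, Thm 2 (1.24), r = 2] -/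
def MordellTwoTermBound (p : ℕ) [Fact p.Prime] (L t K₀ : ℕ) : Prop :=
  ∀ θ₁ θ₂ : ZMod p, θ₁ ≠ 0 → θ₂ ≠ 0 → L < orderOf θ₁ → L < orderOf θ₂ →
    L < orderOf (θ₁ * θ₂⁻¹) → ∀ a₁ a₂ : ZMod p, a₁ ≠ 0 → a₂ ≠ 0 →
    ‖∑ s : Fin t, ((ZMod.stdAddChar : AddChar (ZMod p) ℂ)
      (a₁ * θ₁ ^ ((s : ℕ) + 1) + a₂ * θ₂ ^ ((s : ℕ) + 1)) : ℂ)‖ ≤ K₀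

/-- **Bourgain 2005, Theorem 2 for `r ≤ 2`, natural-number form** (NAMED FACT, not proved here).
For every `k ≥ 1` (`ε = 1/k`) there are `j ≥ 1` (`δ = 1/j`) and `p₀` such that for all primes
`p ≥ p₀` and all `L, t, K₀ : ℕ` with `p < (L+1)^k` (order `> L` forces order `> p^ε`), `p < t^k`
(`t > p^ε`) and `t^j ≤ K₀^j · p` (`K₀ ≥ p^{-δ} t`): the one-term and the two-term short orbit sums of
length `t` over elements of order `> L` (pairwise ratio of order `> L`) with nonzero coefficients
have norm `≤ K₀`. Implied by the printed Theorem 2 ((1.24) p. 480 under (1.19)–(1.20) p. 479, with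
`δ = δ(r, ε)` of Theorem 1 p. 477, `r ∈ {1, 2}`), and weaker than it (see the module docstring).
[cite: Bourgain2005, Thm 2 (1.24) p.480 under (1.19)-(1.20) p.479] -/
def BourgainMordellTwoTerm : Prop :=
  ∀ k : ℕ, 1 ≤ k → ∃ j p₀ : ℕ, 1 ≤ j ∧ ∀ (p : ℕ) [Fact p.Prime], p₀ ≤ p → ∀ L t K₀ : ℕ,
    p < (L + 1) ^ k → p < t ^ k → t ^ j ≤ K₀ ^ j * p →
      MordellOneTermBound p L t K₀ ∧ MordellTwoTermBound p L t K₀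

end Literature.NumberTheory.GaussSums

end
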